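import Summits.Ventures.PercRepro.RankLevelSetCross

/-!
# PercRepro — C-025: the EXACT single-element identities, the cross term `D_e`, the general step (night-1, gen 0)

`proofs/MINE2-RLS.md` §6 (6.1)–(6.3), in the kernel with the cross term made explicit (vocabulary of
`RankLevelSetCross`: `partCount M e a b α β` = `n^{αβ}_{ab}`, `freeCount M e a b` = `n⁰⁰_{ab}`).

* `topCount_eq_succ_succ` — `#U_M(a+1, b+1)` by whether `e ∈ A`: `A ∌ e` has `r(E ∖ A) = r(E' ∖ A) + [e ∉ cl(E' ∖ A)]`,
  `A ∋ e` has `r(A) = r(A ∖ e) + [e ∉ cl(A ∖ e)]`;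
* **`topCount_delete_contract_identity`** — (6.2) EXACT, subtraction-free:
  `#U_M(p+1, q+1) + n⁰⁰_{p+1,q+1} + n⁰⁰_{p,q} = #U_{M∖e}(p+1, q+1) + #U_{M/e}(p, q) + n⁰⁰_{p+1,q} + n⁰⁰_{p,q+1}`,
  i.e. `#U_M = #U_{M∖e} + #U_{M/e} + D_e` with `D_e = n⁰⁰_{p+1,q} + n⁰⁰_{p,q+1} − n⁰⁰_{p+1,q+1} − n⁰⁰_{p,q}`;
* **`midCount_delete_contract_identity`** — (6.1) EXACT: `#Y_M(p+1, q+1) = #Y_{M∖e}(p+1, q+1) + #Y_{M/e}(p, q)`;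
* **`c025_step_of_delete_contract_cross`** — (6.3): the `C025` body for `M` at `(p+1, q+1)` from the bodies for
  `M ＼ {e}` at `(p+1, q+1)` and `M ／ {e}` at `(p, q)` PLUS the signed cross condition
  `Φ(p+1,q+1)·(n⁰⁰_{p+1,q} + n⁰⁰_{p,q+1}) ≤ Φ(p+1,q+1)·(n⁰⁰_{p+1,q+1} + n⁰⁰_{p,q}) + (Φ(p,q) − Φ(p+1,q+1))·#U_{M/e}(p, q)`
  — the induction closes at `e` exactly when this holds (p3's `c025_step_of_delete_contract` is the case where
  all `n⁰⁰` vanish);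
* `freeCount_eq_zero_of_eRank` (and `'`) — in a matroid of rank `a` no `e`-free partition has a side of rank `a` (its
  closure is `E ∋ e`), so after truncation to rank `p+1` (Theorem K) the cross term is `n⁰⁰_{p,q+1} − n⁰⁰_{p,q}`.
Axioms: standard.
-/

open scoped Matroid

namespace PercRepro

namespace Matroid

open Set

variable {α : Type} {M : _root_.Matroid α} {e : α}

section Finite

variable [M.Finite]

omit [M.Finite] in
/-- The complement in `E` of an `A ∌ e` is `insert e` of its complement in `E ∖ {e}`. -/
lemma ground_sdiff_eq_insert (heE : e ∈ M.E) {A : Set α} (heA : e ∉ A) :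
    M.E \ A = insert e ((M.E \ {e}) \ A) := by
  ext x
  simp only [mem_sdiff, mem_singleton_iff, mem_insert_iff]
  constructor
  · rintro ⟨hxE, hxA⟩
    by_cases hxe : x = e
    · exact Or.inl hxe
    · exact Or.inr ⟨⟨hxE, hxe⟩, hxA⟩
  · rintro (rfl | ⟨⟨hxE, -⟩, hxA⟩)
    · exact ⟨heE, heA⟩
    · exact ⟨hxE, hxA⟩

omit [M.Finite] in
/-- The complement in `E` of an `A ∋ e` is the complement of `A ∖ {e}` in `E ∖ {e}`. -/
lemma ground_sdiff_eq_of_mem {A : Set α} (heA : e ∈ A) :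
    M.E \ A = (M.E \ {e}) \ (A \ {e}) := by
  ext x
  simp only [mem_sdiff, mem_singleton_iff]
  constructor
  · rintro ⟨hxE, hxA⟩
    exact ⟨⟨hxE, fun hxe => hxA (hxe ▸ heA)⟩, fun h => hxA h.1⟩
  · rintro ⟨⟨hxE, hxe⟩, h⟩
    exact ⟨hxE, fun hxA => h ⟨hxA, hxe⟩⟩

/-- **`#U_M(a+1, b+1)` by the position of `e`** (`e ∈ E`): the partitions `(A, E ∖ A)` with `e ∉ A` are the
`A' ⊆ E ∖ {e}` with `r(A') = a+1` and `r(E' ∖ A') + [e ∉ cl(E' ∖ A')] = b+1`; those with `e ∈ A` are the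
`A' = A ∖ {e}` with `r(A') + [e ∉ cl A'] = a+1` and `r(E' ∖ A') = b+1`. -/
theorem topCount_eq_succ_succ (heE : e ∈ M.E) (a b : ℕ) :
    topCount M (a + 1) (b + 1) =
      (partCount M e (a + 1) (b + 1) True True + partCount M e (a + 1) (b + 1) False True +
        partCount M e (a + 1) b True False + partCount M e (a + 1) b False False) +
      (partCount M e (a + 1) (b + 1) True True + partCount M e (a + 1) (b + 1) True False +
        partCount M e a (b + 1) False True + partCount M e a (b + 1) False False) := by
  unfold topCount
  set S := {A : Set α | A ⊆ M.E ∧ M.eRk A = ((a + 1 : ℕ) : ℕ∞) ∧ M.eRk (M.E \ A) = ((b + 1 : ℕ) : ℕ∞)}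
    with hS
  have hSfin : S.Finite := M.ground_finite.finite_subsets.subset (fun _ hA => hA.1)
  rw [ncard_split hSfin (fun A => e ∈ A)]
  -- the part with `e ∉ A`
  have hout : {A | A ∈ S ∧ ¬ e ∈ A} =
      {A : Set α | A ⊆ M.E \ {e} ∧ M.eRk A = ((a + 1 : ℕ) : ℕ∞) ∧
        M.eRk ((M.E \ {e}) \ A) = ((b + 1 : ℕ) : ℕ∞) ∧ e ∈ M.closure ((M.E \ {e}) \ A)} ∪
      {A : Set α | A ⊆ M.E \ {e} ∧ M.eRk A = ((a + 1 : ℕ) : ℕ∞) ∧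
        M.eRk ((M.E \ {e}) \ A) = (b : ℕ∞) ∧ e ∉ M.closure ((M.E \ {e}) \ A)} := by
    ext A
    simp only [hS, mem_setOf_eq, mem_union]
    constructor
    · rintro ⟨⟨hA, h1, h2⟩, heA⟩
      have hA' : A ⊆ M.E \ {e} := fun x hx => ⟨hA hx, fun hxe => heA (hxe ▸ hx)⟩
      rw [ground_sdiff_eq_insert heE heA] at h2
      by_cases hcl : e ∈ M.closure ((M.E \ {e}) \ A)
      · left
        rw [eRk_insert_eq_of_mem_closure (sdiff_subset.trans sdiff_subset) hcl] at h2
        exact ⟨hA', h1, h2, hcl⟩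
      · right
        rw [eRk_insert_eq_add_one_of_notMem_closure heE hcl, add_one_eq_coe_succ_iff] at h2
        exact ⟨hA', h1, h2, hcl⟩
    · rintro (⟨hA', h1, h2, hcl⟩ | ⟨hA', h1, h2, hcl⟩)
      · have heA : e ∉ A := fun h => (hA' h).2 rfl
        refine ⟨⟨hA'.trans sdiff_subset, h1, ?_⟩, heA⟩
        rw [ground_sdiff_eq_insert heE heA, eRk_insert_eq_of_mem_closure (sdiff_subset.trans sdiff_subset) hcl]
        exact h2
      · have heA : e ∉ A := fun h => (hA' h).2 rfl
        refine ⟨⟨hA'.trans sdiff_subset, h1, ?_⟩, heA⟩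
        rw [ground_sdiff_eq_insert heE heA, eRk_insert_eq_add_one_of_notMem_closure heE hcl, h2]
        push_cast; rfl
  -- the part with `e ∈ A`, transported by `A ↦ A ∖ {e}`
  have hin : {A | A ∈ S ∧ e ∈ A}.ncard =
      ({A : Set α | A ⊆ M.E \ {e} ∧ M.eRk A = ((a + 1 : ℕ) : ℕ∞) ∧
        M.eRk ((M.E \ {e}) \ A) = ((b + 1 : ℕ) : ℕ∞) ∧ e ∈ M.closure A} ∪
      {A : Set α | A ⊆ M.E \ {e} ∧ M.eRk A = (a : ℕ∞) ∧
        M.eRk ((M.E \ {e}) \ A) = ((b + 1 : ℕ) : ℕ∞) ∧ e ∉ M.closure A}).ncard := by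
    have himg : {A | A ∈ S ∧ e ∈ A} = (fun A => insert e A) ''
        ({A : Set α | A ⊆ M.E \ {e} ∧ M.eRk A = ((a + 1 : ℕ) : ℕ∞) ∧
          M.eRk ((M.E \ {e}) \ A) = ((b + 1 : ℕ) : ℕ∞) ∧ e ∈ M.closure A} ∪
        {A : Set α | A ⊆ M.E \ {e} ∧ M.eRk A = (a : ℕ∞) ∧
          M.eRk ((M.E \ {e}) \ A) = ((b + 1 : ℕ) : ℕ∞) ∧ e ∉ M.closure A}) := by
      ext A
      simp only [hS, mem_setOf_eq, mem_image, mem_union]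
      constructor
      · rintro ⟨⟨hA, h1, h2⟩, heA⟩
        refine ⟨A \ {e}, ?_, by rw [insert_sdiff_singleton, insert_eq_of_mem heA]⟩
        have hA' : A \ {e} ⊆ M.E \ {e} := sdiff_subset_sdiff_left hA
        rw [ground_sdiff_eq_of_mem heA] at h2
        have hAeq : insert e (A \ {e}) = A := by rw [insert_sdiff_singleton, insert_eq_of_mem heA]
        by_cases hcl : e ∈ M.closure (A \ {e})
        · left
          rw [← hAeq, eRk_insert_eq_of_mem_closure (hA'.trans sdiff_subset) hcl] at h1
          exact ⟨hA', h1, h2, hcl⟩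
        · right
          rw [← hAeq, eRk_insert_eq_add_one_of_notMem_closure heE hcl, add_one_eq_coe_succ_iff] at h1
          exact ⟨hA', h1, h2, hcl⟩
      · rintro ⟨A', (⟨hA', h1, h2, hcl⟩ | ⟨hA', h1, h2, hcl⟩), rfl⟩
        · have heA' : e ∉ A' := fun h => (hA' h).2 rfl
          refine ⟨⟨insert_subset heE (hA'.trans sdiff_subset), ?_, ?_⟩, mem_insert e A'⟩
          · rw [eRk_insert_eq_of_mem_closure (hA'.trans sdiff_subset) hcl]; exact h1
          · rw [ground_sdiff_eq_of_mem (mem_insert e A'), insert_sdiff_self_of_notMem heA']; exact h2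
        · have heA' : e ∉ A' := fun h => (hA' h).2 rfl
          refine ⟨⟨insert_subset heE (hA'.trans sdiff_subset), ?_, ?_⟩, mem_insert e A'⟩
          · rw [eRk_insert_eq_add_one_of_notMem_closure heE hcl, h1]; push_cast; rfl
          · rw [ground_sdiff_eq_of_mem (mem_insert e A'), insert_sdiff_self_of_notMem heA']; exact h2
    rw [himg]
    apply InjOn.ncard_image
    rintro A (hA | hA) A' (hA' | hA') hEq <;>
    · have h1 : e ∉ A := fun h => (hA.1 h).2 rfl
      have h2 : e ∉ A' := fun h => (hA'.1 h).2 rfl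
      simp only at hEq
      rw [← insert_sdiff_self_of_notMem h1, ← insert_sdiff_self_of_notMem h2, hEq]
  rw [hout, hin]
  -- count the unions
  have hfin : ∀ (P : Set α → Prop) (a' b' : ℕ),
      {A : Set α | A ⊆ M.E \ {e} ∧ M.eRk A = (a' : ℕ∞) ∧ M.eRk ((M.E \ {e}) \ A) = (b' : ℕ∞) ∧ P A}.Finite :=
    fun P a' b' => (M.ground_finite.subset sdiff_subset).finite_subsets.subset (fun _ hA => hA.1)
  rw [ncard_union_eq ?_ (hfin _ _ _) (hfin _ _ _), ncard_union_eq ?_ (hfin _ _ _) (hfin _ _ _)]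
  · -- the four pieces are sums of two patterns each
    have e1 : ∀ (a' b' : ℕ), {A : Set α | A ⊆ M.E \ {e} ∧ M.eRk A = (a' : ℕ∞) ∧
        M.eRk ((M.E \ {e}) \ A) = (b' : ℕ∞) ∧ e ∈ M.closure ((M.E \ {e}) \ A)}.ncard =
        partCount M e a' b' True True + partCount M e a' b' False True := by
      intro a' b'
      rw [ncard_split (hfin _ _ _) (fun A => e ∈ M.closure A)]
      unfold partCount partSet
      congr 1 <;> · congr 1; ext A; simp only [mem_setOf_eq, iff_true, iff_false]; tauto
    have e2 : ∀ (a' b' : ℕ), {A : Set α | A ⊆ M.E \ {e} ∧ M.eRk A = (a' : ℕ∞) ∧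
        M.eRk ((M.E \ {e}) \ A) = (b' : ℕ∞) ∧ e ∉ M.closure ((M.E \ {e}) \ A)}.ncard =
        partCount M e a' b' True False + partCount M e a' b' False False := by
      intro a' b'
      rw [ncard_split (hfin _ _ _) (fun A => e ∈ M.closure A)]
      unfold partCount partSet
      congr 1 <;> · congr 1; ext A; simp only [mem_setOf_eq, iff_true, iff_false]; tauto
    have e3 : ∀ (a' b' : ℕ), {A : Set α | A ⊆ M.E \ {e} ∧ M.eRk A = (a' : ℕ∞) ∧
        M.eRk ((M.E \ {e}) \ A) = (b' : ℕ∞) ∧ e ∈ M.closure A}.ncard =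
        partCount M e a' b' True True + partCount M e a' b' True False := by
      intro a' b'
      rw [ncard_split (hfin _ _ _) (fun A => e ∈ M.closure ((M.E \ {e}) \ A))]
      unfold partCount partSet
      congr 1 <;> · congr 1; ext A; simp only [mem_setOf_eq, iff_true, iff_false]; tauto
    have e4 : ∀ (a' b' : ℕ), {A : Set α | A ⊆ M.E \ {e} ∧ M.eRk A = (a' : ℕ∞) ∧
        M.eRk ((M.E \ {e}) \ A) = (b' : ℕ∞) ∧ e ∉ M.closure A}.ncard =
        partCount M e a' b' False True + partCount M e a' b' False False := by
      intro a' b'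
      rw [ncard_split (hfin _ _ _) (fun A => e ∈ M.closure ((M.E \ {e}) \ A))]
      unfold partCount partSet
      congr 1 <;> · congr 1; ext A; simp only [mem_setOf_eq, iff_true, iff_false]; tauto
    rw [e1, e2, e3, e4]
    ring
  · rw [disjoint_left]
    rintro A ⟨-, -, -, h1⟩ ⟨-, -, -, h2⟩
    exact h2 h1
  · rw [disjoint_left]
    rintro A ⟨-, -, -, h1⟩ ⟨-, -, -, h2⟩
    exact h2 h1

/-- **(6.2) EXACT** (mine-2 §6, subtraction-free): for a non-loop `e`,
`#U_M(p+1, q+1) + n⁰⁰_{p+1,q+1} + n⁰⁰_{p,q} = #U_{M∖e}(p+1, q+1) + #U_{M/e}(p, q) + n⁰⁰_{p+1,q} + n⁰⁰_{p,q+1}` —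
that is `#U_M = #U_{M∖e} + #U_{M/e} + D_e` with the cross term
`D_e = n⁰⁰_{p+1,q} + n⁰⁰_{p,q+1} − n⁰⁰_{p+1,q+1} − n⁰⁰_{p,q}` (`n⁰⁰ = freeCount`). -/
theorem topCount_delete_contract_identity (he : M.Indep {e}) (p q : ℕ) :
    topCount M (p + 1) (q + 1) + freeCount M e (p + 1) (q + 1) + freeCount M e p q =
      topCount (M ＼ {e}) (p + 1) (q + 1) + topCount (M ／ {e}) p q +
        freeCount M e (p + 1) q + freeCount M e p (q + 1) := by
  have heE : e ∈ M.E := he.subset_ground (mem_singleton e)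
  rw [topCount_eq_succ_succ heE, topCount_delete_eq, topCount_contract_eq he]
  unfold freeCount
  ring

/-- **(6.1) EXACT** (mine-2 §6): for a non-loop `e`, `#Y_M(p+1, q+1) = #Y_{M∖e}(p+1, q+1) + #Y_{M/e}(p, q)`. -/
theorem midCount_delete_contract_identity (he : M.Indep {e}) (p q : ℕ) :
    midCount M (p + 1) (q + 1) = midCount (M ＼ {e}) (p + 1) (q + 1) + midCount (M ／ {e}) p q := by
  have heE : e ∈ M.E := he.subset_ground (mem_singleton e)
  unfold midCount
  set Y := {A : Set α | A ⊆ M.E ∧ ((q + 1 : ℕ) : ℕ∞) < M.eRk A ∧ M.eRk A < ((p + 1 : ℕ) : ℕ∞)} with hY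
  have hYfin : Y.Finite := M.ground_finite.finite_subsets.subset (fun _ hA => hA.1)
  rw [ncard_split hYfin (fun A => e ∈ A)]
  have hout : {A | A ∈ Y ∧ ¬ e ∈ A} = {A : Set α | A ⊆ (M ＼ {e}).E ∧
      ((q + 1 : ℕ) : ℕ∞) < (M ＼ {e}).eRk A ∧ (M ＼ {e}).eRk A < ((p + 1 : ℕ) : ℕ∞)} := by
    ext A
    simp only [hY, mem_setOf_eq, _root_.Matroid.delete_ground]
    constructor
    · rintro ⟨⟨hA, h1, h2⟩, heA⟩
      have hA' : A ⊆ M.E \ {e} := fun x hx => ⟨hA hx, fun hxe => heA (hxe ▸ hx)⟩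
      rw [delete_singleton_eRk_eq hA']
      exact ⟨hA', h1, h2⟩
    · rintro ⟨hA', h1, h2⟩
      rw [delete_singleton_eRk_eq hA'] at h1 h2
      exact ⟨⟨hA'.trans sdiff_subset, h1, h2⟩, fun h => (hA' h).2 rfl⟩
  have hin : {A | A ∈ Y ∧ e ∈ A} = (fun A => insert e A) ''
      {A : Set α | A ⊆ (M ／ {e}).E ∧ (q : ℕ∞) < (M ／ {e}).eRk A ∧ (M ／ {e}).eRk A < (p : ℕ∞)} := by
    ext A
    simp only [hY, mem_setOf_eq, mem_image, _root_.Matroid.contract_ground]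
    constructor
    · rintro ⟨⟨hA, h1, h2⟩, heA⟩
      refine ⟨A \ {e}, ⟨sdiff_subset_sdiff_left hA, ?_, ?_⟩,
        by rw [insert_sdiff_singleton, insert_eq_of_mem heA]⟩
      · have hr := contract_singleton_eRk_add_one he (sdiff_subset_sdiff_left hA : A \ {e} ⊆ M.E \ {e})
        rw [insert_sdiff_singleton, insert_eq_of_mem heA] at hr
        rw [← hr] at h1
        push_cast at h1
        exact (ENat.add_lt_add_iff_right (by simp)).1 h1
      · have hr := contract_singleton_eRk_add_one he (sdiff_subset_sdiff_left hA : A \ {e} ⊆ M.E \ {e})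
        rw [insert_sdiff_singleton, insert_eq_of_mem heA] at hr
        rw [← hr] at h2
        push_cast at h2
        exact (ENat.add_lt_add_iff_right (by simp)).1 h2
    · rintro ⟨A', ⟨hA', h1, h2⟩, rfl⟩
      have hr := contract_singleton_eRk_add_one he hA'
      refine ⟨⟨insert_subset heE (hA'.trans sdiff_subset), ?_, ?_⟩, mem_insert e A'⟩
      · rw [← hr]; push_cast; exact (ENat.add_lt_add_iff_right (by simp)).2 h1
      · rw [← hr]; push_cast; exact (ENat.add_lt_add_iff_right (by simp)).2 h2
  rw [hout, hin, InjOn.ncard_image, add_comm]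
  intro A hA A' hA' hEq
  have h1 : e ∉ A := fun h => (hA.1 h).2 rfl
  have h2 : e ∉ A' := fun h => (hA'.1 h).2 rfl
  simp only at hEq
  rw [← insert_sdiff_self_of_notMem h1, ← insert_sdiff_self_of_notMem h2, hEq]

/-- The arithmetic of the general step: from `u + f₁ + f₂ = u₁ + u₂ + g₁ + g₂`, `y = y₁ + y₂`, `a·u₁ ≤ y₁`,
`b·u₂ ≤ y₂` and the signed cross condition `a·(g₁ + g₂) ≤ a·(f₁ + f₂) + (b − a)·u₂`,
conclude `a·u ≤ y` (no sign condition on `a`, `b` is needed). -/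
lemma step_arith_cross {a b : ℚ} {u u₁ u₂ y y₁ y₂ f₁ f₂ g₁ g₂ : ℕ}
    (hU : u + f₁ + f₂ = u₁ + u₂ + g₁ + g₂) (hY : y = y₁ + y₂)
    (h1 : a * (u₁ : ℚ) ≤ y₁) (h2 : b * (u₂ : ℚ) ≤ y₂)
    (hcross : a * ((g₁ : ℚ) + g₂) ≤ a * ((f₁ : ℚ) + f₂) + (b - a) * (u₂ : ℚ)) : a * (u : ℚ) ≤ y := by
  have hU' : (u : ℚ) + f₁ + f₂ = u₁ + u₂ + g₁ + g₂ := by exact_mod_cast hU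
  have hY' : (y : ℚ) = y₁ + y₂ := by exact_mod_cast hY
  have h3 : a * (u : ℚ) = a * (u₁ : ℚ) + a * (u₂ : ℚ) + (a * ((g₁ : ℚ) + g₂) - a * ((f₁ : ℚ) + f₂)) := by
    have : (u : ℚ) = u₁ + u₂ + (g₁ + g₂) - (f₁ + f₂) := by linarith
    rw [this]; ring
  nlinarith [h1, h2, hcross, h3, hY']

/-- **The single-element induction step of C-025 with the cross term** (mine-2 §6 (6.3), exact form): for a
non-loop `e`, the `C025` body for `M` at `(p+1, q+1)` follows from the bodies for `M ＼ {e}` at `(p+1, q+1)` and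
`M ／ {e}` at `(p, q)` together with the SIGNED CROSS CONDITION
`Φ(p+1,q+1)·(n⁰⁰_{p+1,q} + n⁰⁰_{p,q+1}) ≤ Φ(p+1,q+1)·(n⁰⁰_{p+1,q+1} + n⁰⁰_{p,q}) + (Φ(p,q) − Φ(p+1,q+1))·#U_{M/e}(p,q)`
(`Φ(p+1,q+1)·D_e ≤ (Φ(p,q) − Φ(p+1,q+1))·#U_{M/e}(p,q)`); it is the whole of what the induction at `e` needs. -/
theorem c025_step_of_delete_contract_cross (he : M.Indep {e}) (p q : ℕ)
    (h1 : phiK (p + 1) (q + 1) * (topCount (M ＼ {e}) (p + 1) (q + 1) : ℚ) ≤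
      (midCount (M ＼ {e}) (p + 1) (q + 1) : ℚ))
    (h2 : phiK p q * (topCount (M ／ {e}) p q : ℚ) ≤ (midCount (M ／ {e}) p q : ℚ))
    (hcross : phiK (p + 1) (q + 1) * ((freeCount M e (p + 1) q : ℚ) + freeCount M e p (q + 1)) ≤
      phiK (p + 1) (q + 1) * ((freeCount M e (p + 1) (q + 1) : ℚ) + freeCount M e p q) +
        (phiK p q - phiK (p + 1) (q + 1)) * (topCount (M ／ {e}) p q : ℚ)) :
    phiK (p + 1) (q + 1) * (topCount M (p + 1) (q + 1) : ℚ) ≤ (midCount M (p + 1) (q + 1) : ℚ) := by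
  exact step_arith_cross (topCount_delete_contract_identity he p q)
    (midCount_delete_contract_identity he p q) h1 h2 hcross

omit [M.Finite] in
/-- The `C025` body in `topCount` / `midCount` vocabulary equals its set-builder spelling. -/
theorem body_eq_iff (p q : ℕ) :
    (phiK p q * (topCount M p q : ℚ) ≤ (midCount M p q : ℚ)) ↔
      (phiK p q * ({A : Set α | A ⊆ M.E ∧ M.eRk A = (p : ℕ∞) ∧ M.eRk (M.E \ A) = (q : ℕ∞)}.ncard : ℚ) ≤
        ({A : Set α | A ⊆ M.E ∧ (q : ℕ∞) < M.eRk A ∧ M.eRk A < (p : ℕ∞)}.ncard : ℚ)) :=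
  Iff.rfl

/-- **No `e`-free partition has a side of full rank**: if `r(M) = a` then `freeCount M e a b = 0` for every `b`
(a set of rank `a` spans `M`, so its closure is `E ∋ e`). After truncation to rank `p+1` (Theorem K) the cross
term of `topCount_delete_contract_identity` is therefore `n⁰⁰_{p,q+1} − n⁰⁰_{p,q}`. -/
theorem freeCount_eq_zero_of_eRank (heE : e ∈ M.E) {a : ℕ} (hR : M.eRank = (a : ℕ∞)) (b : ℕ) :
    freeCount M e a b = 0 := by
  unfold freeCount partCount
  rw [ncard_eq_zero (partSet_finite a b False False), eq_empty_iff_forall_notMem]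
  intro A hA
  obtain ⟨hA, hra, -, hcl, -⟩ : A ⊆ M.E \ {e} ∧ M.eRk A = (a : ℕ∞) ∧
    M.eRk ((M.E \ {e}) \ A) = (b : ℕ∞) ∧ (e ∈ M.closure A ↔ False) ∧
    (e ∈ M.closure ((M.E \ {e}) \ A) ↔ False) := hA
  rw [iff_false] at hcl
  apply hcl
  have hAE : A ⊆ M.E := hA.trans sdiff_subset
  have hsp : M.Spanning A :=
    (_root_.Matroid.spanning_iff_eRk_le').2 ⟨by rw [hra, hR], hAE⟩
  rw [(_root_.Matroid.spanning_iff_closure_eq hAE).1 hsp]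
  exact heE

/-- The symmetric statement: no `e`-free partition has its complement of full rank. -/
theorem freeCount_eq_zero_of_eRank' (heE : e ∈ M.E) {b : ℕ} (hR : M.eRank = (b : ℕ∞)) (a : ℕ) :
    freeCount M e a b = 0 := by
  unfold freeCount partCount
  rw [ncard_eq_zero (partSet_finite a b False False), eq_empty_iff_forall_notMem]
  intro A hA
  obtain ⟨hA, -, hrb, -, hcl⟩ : A ⊆ M.E \ {e} ∧ M.eRk A = (a : ℕ∞) ∧
    M.eRk ((M.E \ {e}) \ A) = (b : ℕ∞) ∧ (e ∈ M.closure A ↔ False) ∧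
    (e ∈ M.closure ((M.E \ {e}) \ A) ↔ False) := hA
  rw [iff_false] at hcl
  apply hcl
  have hBE : (M.E \ {e}) \ A ⊆ M.E := sdiff_subset.trans sdiff_subset
  have hsp : M.Spanning ((M.E \ {e}) \ A) :=
    (_root_.Matroid.spanning_iff_eRk_le').2 ⟨by rw [hrb, hR], hBE⟩
  rw [(_root_.Matroid.spanning_iff_closure_eq hBE).1 hsp]
  exact heE

end Finite

end Matroid

end PercRepro

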